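import Literature.Analysis.FluidPDE.TaoClassGlue
import Literature.Analysis.FluidPDE.EnstrophyGronwall
import Literature.Analysis.FluidPDE.H1ContinuationSobolevClass
import Literature.Analysis.FluidPDE.TaoLocalisation
import Literature.Analysis.FluidPDE.TaoLocalisationContinuation
import HarnessLib

/-!
# Route `GaldiLiouvilleGate`, crux `RecordZoomAncient` (stmt-NavierStokesRegularity-0894),
  line `registered` (birth skeleton, reshape r3) — stub `stub_fastBranch`
  (the fast-doubling branch of the concentration step: "production forces concentration")

**Statement.** Write `E(s) = ∫⁻ |∇u(s)|²` (an extended nonnegative real) for a classical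
solution `u` of the unforced Navier–Stokes system on `ℝ³ × [0, T)` which is Leray–Hopf, is a
Tao-class solution on every closed sub-slab `[0, T']`, `T' < T`, and admits no smooth extension
past `T`. Inputs: the persistence bound of the enstrophy (`E(t₀) ≤ L ⇒ E(t) ≤ K_P L` for
`t ∈ [t₀, T)` with `t − t₀ ≤ c_P ν³/L²`), a scale `K > 0`, and FAST DOUBLING at scale `K`
arbitrarily close to `T`: times `t₁ < t₂ < T` and a level `L > 0` with `E(t₁) ≤ L`,
`E(t₂) ≥ 2L`, `E ≤ 2L` on `[0, t₂]` and `t₂ − t₁ < K ν³/L²`. Output: base times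
`tc n ∈ (0, T)`, centres `xc n`, levels `L n > 0` dominating `E` on `[0, tc n]`, a rescaled time
`s₀ < 0` and a `θ > 0` with `tc n · (L n)² → ∞` and `θ ≤ ‖(ν / L n) • u (tc n + ν³ s₀/(L n)²) (xc n)‖`.

**Proof.** (a) `E` is unbounded on `[0, T)`: otherwise the uniform `H¹` bound (energy from the
Leray–Hopf energy inequality `IsLerayHopfOn.lintegral_enorm_sq_le`, Sobolev class from the Tao
representation) continues `u` past `T` (`hasSobolevExtensionPast_of_uniform_H1_bound`,
`HasSobolevExtensionPast.hasSmoothExtensionPast`). (b) ROOM: if `E ≤ L'` on `[0, t]` then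
`T − t > c_P ν³/L'²` (else persistence bounds `E` by `K_P L'` on `[0, T)`, contradicting (a)).
(c) `E ≤ 3 C₁` on `[0, T/2]` (Sobolev bound of the representation on `[0, T/2]`).
(d) Probing at times `t*ₙ > T/2` where `E(t*ₙ) > n`, fast doubling gives `t₁ ≥ t*ₙ`, `t₂`, `L`
with `n < 2L`. (e) SERRIN: if `|u| ≤ m L/ν` on `[t₁, t₂] × ℝ³`, `m = √(2 log 2/K)`, then
Serrin's endpoint enstrophy inequality on the restarted slab `[0, t₂ − t₁]`
(`lintegral_frobeniusNormSq_fderiv_le_mul_exp`, with `IsTaoSolutionOn.translate`/`.mono`) gives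
`2L ≤ E(t₂) ≤ exp((mL/ν)²(t₂−t₁)/(2ν)) L < exp(log 2) L = 2L`, absurd; so some `(s, x)`,
`s ∈ [t₁, t₂]`, has `‖u(s, x)‖ > m L/ν`. (f) Witnesses: `L n = K_P · 2L`, `xc n = x`,
`tc n = s + c_P ν³/(8L²)` (inside the room of (b), and `E ≤ L n` on `[0, tc n]` by `E ≤ 2L` on
`[0, s]` and persistence from `s`), `s₀ = −c_P K_P²/2` (so that the rescaled time `s₀` of the
zoom based at `tc n` is the original time `s`), `θ = m/(2 K_P)`; finally `tc n > T/2` and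
`L n > n` give `tc n (L n)² ≥ (T/2) n² → ∞`.
-/

noncomputable section

open Set MeasureTheory Filter Topology Function
open scoped ENNReal NNReal
open Literature.Analysis.FluidPDE

namespace Summit.NavierStokesRegularity.NavierStokesRegularity.Theorems.RecordZoomAncient.Birth

-- the problem-side namespace `Summit.NavierStokesRegularity.NavierStokesRegularity.…` (summit =
-- problem for this single-problem summit) duplicates `NavierStokesRegularity` by design
set_option linter.dupNamespace false

/-- **(a) The enstrophy is unbounded before a blow-up time.** For a classical solution on
`[0, T)` which is Leray–Hopf, Tao-class on every `[0, T']`, `T' < T`, and has no smooth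
extension past `T`, the enstrophy `E(t) = ∫⁻ |∇u(t)|²` exceeds every finite level somewhere on
`[0, T)`: otherwise `‖u(t)‖²_{L²} + ‖∇u(t)‖²_{L²}` is bounded on `[0, T)` (energy inequality) and
`hasSobolevExtensionPast_of_uniform_H1_bound` continues `u` past `T`. -/
private theorem exists_enstrophy_gt {ν T : ℝ} (hν : 0 < ν) (hT : 0 < T)
    {u : ℝ → EuclideanSpace ℝ (Fin 3) → EuclideanSpace ℝ (Fin 3)}
    {p : ℝ → EuclideanSpace ℝ (Fin 3) → ℝ}
    (hsol : IsClassicalNSSolutionOn (Ico 0 T) ν 0 u p) (hLH : IsLerayHopfOn T ν 0 (u 0) u)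
    (hrep : ∀ T' ∈ Ioo 0 T, ∃ P : ℝ → EuclideanSpace ℝ (Fin 3) → ℝ,
      IsTaoSolutionOn T' ν (u 0) u P)
    (hnext : ¬ HasSmoothExtensionPast ν 0 u T) {E : ℝ → ℝ≥0∞}
    (hE : ∀ s, E s = ∫⁻ x, ENNReal.ofReal (frobeniusNormSq (fderiv ℝ (u s) x))) {M : ℝ≥0∞}
    (hM : M < ⊤) : ∃ t ∈ Ico 0 T, M < E t := by
  by_contra h
  push Not at h
  -- the Sobolev class on every `[0, T'']`, `T'' < T`, from the representation
  have hreg : ∀ T'' < T, HasBoundedSobolevNormsOn (Icc 0 T'') u := fun T'' hT'' => by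
    obtain ⟨P, hP⟩ := hrep (max T'' (T / 2))
      ⟨(half_pos hT).trans_le (le_max_right _ _), max_lt hT'' (half_lt_self hT)⟩
    exact hP.sobolev.mono (Icc_subset_Icc_right (le_max_left _ _))
  have hKE : 0 ≤ VectorCalculus.kineticEnergy (u 0) := kineticEnergy_nonneg _
  have h2KE : 0 ≤ 2 * VectorCalculus.kineticEnergy (u 0) := by positivity
  have hA0 : 0 ≤ 2 * VectorCalculus.kineticEnergy (u 0) + M.toReal :=
    add_nonneg h2KE ENNReal.toReal_nonneg
  refine hnext (hasSobolevExtensionPast_of_uniform_H1_bound hν hT hsol hreg hA0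
    fun t ht => ?_).hasSmoothExtensionPast
  rw [ENNReal.ofReal_add h2KE ENNReal.toReal_nonneg, ENNReal.ofReal_toReal hM.ne, ← hE t]
  exact add_le_add (hLH.lintegral_enorm_sq_le hν.le (Ico_subset_Icc_self ht)) (h t ht)

/-- **(e) Production forces concentration.** If the enstrophy doubles from `E(t₁) ≤ L` to
`E(t₂) ≥ 2L` (`0 ≤ t₁ < t₂ < T`, `L > 0`) in time `t₂ − t₁ < K ν³/L²`, then somewhere on
`[t₁, t₂] × ℝ³` the velocity exceeds `√(2 log 2/K) · L/ν`: otherwise Serrin's endpoint enstrophy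
inequality `lintegral_frobeniusNormSq_fderiv_le_mul_exp` on the restarted Tao-class slab
`[0, t₂ − t₁]` (`IsTaoSolutionOn.translate`, `.mono`) with `M = √(2 log 2/K) L/ν` gives
`E(t₂) ≤ exp(M²(t₂ − t₁)/(2ν)) E(t₁) < exp(log 2) L = 2L`. -/
private theorem exists_velocity_gt {ν T : ℝ} (hν : 0 < ν)
    {u : ℝ → EuclideanSpace ℝ (Fin 3) → EuclideanSpace ℝ (Fin 3)}
    (hrep : ∀ T' ∈ Ioo 0 T, ∃ P : ℝ → EuclideanSpace ℝ (Fin 3) → ℝ,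
      IsTaoSolutionOn T' ν (u 0) u P)
    {E : ℝ → ℝ≥0∞} (hE : ∀ s, E s = ∫⁻ x, ENNReal.ofReal (frobeniusNormSq (fderiv ℝ (u s) x)))
    {t₁ t₂ L K : ℝ} (ht₁ : 0 ≤ t₁) (h12 : t₁ < t₂) (ht₂ : t₂ < T) (hL : 0 < L) (hK : 0 < K)
    (hE₁ : E t₁ ≤ ENNReal.ofReal L) (hE₂ : ENNReal.ofReal (2 * L) ≤ E t₂)
    (hfast : t₂ - t₁ < K * ν ^ 3 / L ^ 2) :
    ∃ s ∈ Icc t₁ t₂, ∃ x, Real.sqrt (2 * Real.log 2 / K) * L / ν < ‖u s x‖ := by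
  have hlog2 : 0 < Real.log 2 := Real.log_pos one_lt_two
  have hm0 : 0 < Real.sqrt (2 * Real.log 2 / K) := Real.sqrt_pos.2 (by positivity)
  have hm2 : Real.sqrt (2 * Real.log 2 / K) ^ 2 = 2 * Real.log 2 / K :=
    Real.sq_sqrt (by positivity)
  by_contra hcon
  push Not at hcon
  set m := Real.sqrt (2 * Real.log 2 / K) with hm
  have hM0 : 0 < m * L / ν := by positivity
  have hτ : 0 < t₂ - t₁ := sub_pos.2 h12
  -- the representation on `[0, (t₂ + T)/2]`, restarted at `t₁` and restricted to `[0, t₂ - t₁]`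
  obtain ⟨P, hP⟩ := hrep ((t₂ + T) / 2) ⟨by linarith, by linarith⟩
  have h2 : IsTaoSolutionOn (t₂ - t₁) ν (u t₁) (fun r => u (r + t₁)) (fun r => P (r + t₁)) :=
    (hP.translate ht₁ (by linarith)).mono hτ (by linarith)
  have hbd : ∀ t ∈ Icc 0 (t₂ - t₁), ∀ x, ‖u (t + t₁) x‖ ≤ m * L / ν := fun t ht x =>
    hcon (t + t₁) ⟨by linarith [ht.1], by linarith [ht.2]⟩ x
  have hs : t₂ - t₁ ∈ Ioc 0 (t₂ - t₁) := ⟨hτ, le_rfl⟩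
  have hgr := lintegral_frobeniusNormSq_fderiv_le_mul_exp hν hτ h2.classical h2.sobolev
    h2.sobolev_dt h2.sobolev_p hM0 hs hbd
  simp only [sub_add_cancel, zero_add, ← hE] at hgr
  -- the exponent is `< log 2`
  have hLτ : L ^ 2 * (t₂ - t₁) < K * ν ^ 3 := by
    have h := (lt_div_iff₀ (by positivity : (0 : ℝ) < L ^ 2)).1 hfast
    linarith [mul_comm (t₂ - t₁) (L ^ 2)]
  have hexp : Real.exp ((m * L / ν) ^ 2 * (t₂ - t₁) / (2 * ν)) < 2 := by
    have heq : (m * L / ν) ^ 2 * (t₂ - t₁) / (2 * ν) =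
        Real.log 2 * (L ^ 2 * (t₂ - t₁) / (K * ν ^ 3)) := by
      rw [div_pow, mul_pow, hm2]
      field_simp
    have hlt : (m * L / ν) ^ 2 * (t₂ - t₁) / (2 * ν) < Real.log 2 := by
      rw [heq]
      calc Real.log 2 * (L ^ 2 * (t₂ - t₁) / (K * ν ^ 3)) < Real.log 2 * 1 :=
            mul_lt_mul_of_pos_left ((div_lt_one (by positivity)).2 hLτ) hlog2
        _ = Real.log 2 := mul_one _
    calc Real.exp ((m * L / ν) ^ 2 * (t₂ - t₁) / (2 * ν)) < Real.exp (Real.log 2) :=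
          Real.exp_lt_exp.2 hlt
      _ = 2 := Real.exp_log two_pos
  have hlt : E t₂ < ENNReal.ofReal (2 * L) :=
    calc E t₂ ≤ ENNReal.ofReal (Real.exp ((m * L / ν) ^ 2 * (t₂ - t₁) / (2 * ν))) * E t₁ := hgr
      _ ≤ ENNReal.ofReal (Real.exp ((m * L / ν) ^ 2 * (t₂ - t₁) / (2 * ν))) *
            ENNReal.ofReal L := mul_le_mul_right hE₁ _
      _ = ENNReal.ofReal (Real.exp ((m * L / ν) ^ 2 * (t₂ - t₁) / (2 * ν)) * L) :=
          (ENNReal.ofReal_mul (Real.exp_pos _).le).symm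
      _ < ENNReal.ofReal (2 * L) :=
          (ENNReal.ofReal_lt_ofReal_iff (by positivity)).2 (mul_lt_mul_of_pos_right hexp hL)
  exact absurd (hE₂.trans_lt hlt) (lt_irrefl _)

/-- The base time `s + c_P ν³/(8L²)` zoomed at level `K_P · 2L` to the rescaled time
`s₀ = −c_P K_P²/2` is the original time `s`. -/
private theorem base_time_identity {ν KP L cP s : ℝ} (hKP : KP ≠ 0) (hL : L ≠ 0) :
    s + cP * ν ^ 3 / (8 * L ^ 2) + ν ^ 3 / (KP * (2 * L)) ^ 2 * -(cP * KP ^ 2 / 2) = s := by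
  field_simp
  ring

/-- At the velocity scale `ν/(K_P · 2L)` the velocity `m L/ν` reads `m/(2 K_P)`. -/
private theorem velocity_scale (m : ℝ) {ν KP L : ℝ} (hν : ν ≠ 0) (hKP : KP ≠ 0) (hL : L ≠ 0) :
    ν / (KP * (2 * L)) * (m * L / ν) = m / (2 * KP) := by
  field_simp

/-- `a/(8L²) ≤ a/(2L)²` for `a ≥ 0`, `L > 0`. -/
private theorem eighth_le_quarter {a L : ℝ} (ha : 0 ≤ a) (hL : 0 < L) :
    a / (8 * L ^ 2) ≤ a / (2 * L) ^ 2 :=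
  div_le_div_of_nonneg_left ha (by positivity) (by nlinarith)

/-- **stub 2b — `stub_fastBranch` (the fast-doubling sub-branch of the concentration step, the
tree's form of lemma (P) "production forces concentration").** Hypotheses: the solution
(classical on `[0, T)`, Leray–Hopf, Tao-class on every `[0, T']`, no smooth extension past `T`),
the persistence bound (constants `c_P > 0`, `K_P ≥ 1`), a scale `K > 0`, and FAST DOUBLING AT
SCALE `K` arbitrarily close to `T`: times `t₁ < t₂ < T` and a level `L > 0` with `E(t₁) ≤ L`,
`E(t₂) ≥ 2L`, `E ≤ 2L` on `[0, t₂]` and `t₂ − t₁ < K ν³/L²`. Conclusion: concentrated zooms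
(format of stub 2a). Proof: (a) `E` is unbounded on `[0, T)` (`exists_enstrophy_gt`); (b) ROOM:
`E ≤ L'` on `[0, t]` forces `T − t > c_P ν³/L'²`; (c) `E` is bounded on `[0, T/2]`; (d) probe
where `E > max n (bound)`; (e) Serrin's endpoint enstrophy inequality on the restarted slab gives
a point `(s, x) ∈ [t₁, t₂] × ℝ³` with `‖u(s, x)‖ > √(2 log 2/K) · L/ν` (`exists_velocity_gt`);
(f) level `L n = K_P · 2L`, base time `tc = s + c_P ν³/(8L²)`, `s₀ = −c_P K_P²/2`,
`θ = √(2 log 2/K)/(2 K_P)`, and `tc n (L n)² ≥ (T/2) n² → ∞`. -/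
theorem stub_fastBranch :
    ∀ (ν T : ℝ), 0 < ν → 0 < T →
      ∀ (u : ℝ → EuclideanSpace ℝ (Fin 3) → EuclideanSpace ℝ (Fin 3)) (p : ℝ → EuclideanSpace ℝ (Fin 3) → ℝ),
        IsClassicalNSSolutionOn (Set.Ico 0 T) ν 0 u p → IsLerayHopfOn T ν 0 (u 0) u →
        (∀ T' ∈ Set.Ioo 0 T, ∃ P : ℝ → EuclideanSpace ℝ (Fin 3) → ℝ, IsTaoSolutionOn T' ν (u 0) u P) →
        ¬ HasSmoothExtensionPast ν 0 u T →
        ∀ cP KP : ℝ, 0 < cP → 1 ≤ KP →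
          (∀ t₀ ∈ Set.Ico 0 T, ∀ L : ℝ, 0 < L →
            (∫⁻ x, ENNReal.ofReal (frobeniusNormSq (fderiv ℝ (u t₀) x))) ≤ ENNReal.ofReal L →
            ∀ t ∈ Set.Ico t₀ T, t - t₀ ≤ cP * ν ^ 3 / L ^ 2 →
              (∫⁻ x, ENNReal.ofReal (frobeniusNormSq (fderiv ℝ (u t) x))) ≤ ENNReal.ofReal (KP * L)) →
        ∀ K : ℝ, 0 < K →
          (∀ t' ∈ Set.Ico 0 T, ∃ t₁ ∈ Set.Ico t' T, ∃ t₂ ∈ Set.Ioo t₁ T, ∃ L : ℝ, 0 < L ∧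
            (∀ s ∈ Set.Icc 0 t₂,
              (∫⁻ x, ENNReal.ofReal (frobeniusNormSq (fderiv ℝ (u s) x))) ≤ ENNReal.ofReal (2 * L)) ∧
            (∫⁻ x, ENNReal.ofReal (frobeniusNormSq (fderiv ℝ (u t₁) x))) ≤ ENNReal.ofReal L ∧
            ENNReal.ofReal (2 * L) ≤ (∫⁻ x, ENNReal.ofReal (frobeniusNormSq (fderiv ℝ (u t₂) x))) ∧
            t₂ - t₁ < K * ν ^ 3 / L ^ 2) →
        ∃ (tc : ℕ → ℝ) (xc : ℕ → EuclideanSpace ℝ (Fin 3)) (L : ℕ → ℝ) (s₀ θ : ℝ),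
          s₀ < 0 ∧ 0 < θ ∧ (∀ n, 0 < tc n ∧ tc n < T) ∧ (∀ n, 0 < L n) ∧
          (∀ n, ∀ t ∈ Set.Icc 0 (tc n),
            ∫⁻ x, ENNReal.ofReal (frobeniusNormSq (fderiv ℝ (u t) x)) ≤ ENNReal.ofReal (L n)) ∧
          Tendsto (fun n => tc n * L n ^ 2) atTop atTop ∧
          (∀ n, θ ≤ ‖(ν / L n) • u (tc n + ν ^ 3 / L n ^ 2 * s₀) (xc n)‖) := by
  intro ν T hν hT u p hsol hLH hrep hnext cP KP hcP hKP hpers K hK hFD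
  have hKP0 : 0 < KP := one_pos.trans_le hKP
  -- the enstrophy `E s = ∫⁻ |∇u(s)|²`
  obtain ⟨E, hE⟩ : ∃ E : ℝ → ℝ≥0∞,
      ∀ s, E s = ∫⁻ x, ENNReal.ofReal (frobeniusNormSq (fderiv ℝ (u s) x)) := ⟨_, fun _ => rfl⟩
  simp only [← hE] at hpers hFD ⊢
  -- (a) unboundedness of `E` on `[0, T)`
  have hunb : ∀ M : ℝ≥0∞, M < ⊤ → ∃ t ∈ Ico 0 T, M < E t := fun M hM =>
    exists_enstrophy_gt hν hT hsol hLH hrep hnext hE hM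
  -- (b) ROOM before `T` below a dominated time
  have hroom : ∀ t ∈ Ico 0 T, ∀ L' : ℝ, 0 < L' → (∀ r ∈ Icc 0 t, E r ≤ ENNReal.ofReal L') →
      cP * ν ^ 3 / L' ^ 2 < T - t := by
    intro t ht L' hL' hdomt
    by_contra hle
    push Not at hle
    obtain ⟨t', ht', hgt⟩ := hunb (ENNReal.ofReal (KP * L')) ENNReal.ofReal_lt_top
    refine absurd ?_ (not_le.2 hgt)
    rcases le_or_gt t' t with h1 | h1
    · exact (hdomt t' ⟨ht'.1, h1⟩).trans
        (ENNReal.ofReal_le_ofReal (le_mul_of_one_le_left hL'.le hKP))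
    · exact hpers t ht L' hL' (hdomt t ⟨ht.1, le_rfl⟩) t' ⟨h1.le, ht'.2⟩ (by linarith [ht'.2])
  -- (c) a bound for `E` on `[0, T/2]`
  obtain ⟨P₀, hP₀⟩ := hrep (T / 2) ⟨half_pos hT, half_lt_self hT⟩
  obtain ⟨C₁, hC₁⟩ := hP₀.sobolev 1
  have hB : ∀ t ∈ Icc 0 (T / 2), E t ≤ 3 * (C₁ : ℝ≥0∞) := fun t ht => by
    rw [hE]
    exact (lintegral_frobeniusNormSq_le_three_mul_iteratedFDeriv_one (u t)).trans
      (mul_le_mul_right (hC₁ t ht) 3)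
  have hBtop : 3 * (C₁ : ℝ≥0∞) < ⊤ := ENNReal.mul_lt_top (by simp) ENNReal.coe_lt_top
  -- (d) probing times `tp n > T/2` with `E (tp n) > n`, and the fast doublings after them
  have hprobe : ∀ n : ℕ, ∃ t ∈ Ico 0 T, T / 2 < t ∧ (n : ℝ≥0∞) < E t := fun n => by
    obtain ⟨t, ht, hgt⟩ :=
      hunb (max (n : ℝ≥0∞) (3 * C₁)) (max_lt (ENNReal.natCast_lt_top n) hBtop)
    refine ⟨t, ht, ?_, (le_max_left _ _).trans_lt hgt⟩
    by_contra hle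
    push Not at hle
    exact absurd ((hB t ⟨ht.1, hle⟩).trans (le_max_right _ _)) (not_le.2 hgt)
  choose tp htp htp2 htpn using hprobe
  choose t₁ ht₁ t₂ ht₂ L hL hdom2 hE₁ hE₂ hfast using fun n => hFD (tp n) (htp n)
  have ht₁0 : ∀ n, 0 ≤ t₁ n := fun n => (htp n).1.trans (ht₁ n).1
  -- (e) points `(s n, x n)` with a velocity of the enstrophy scale
  choose s hs x hx using fun n => exists_velocity_gt hν hrep hE (ht₁0 n) (ht₂ n).1 (ht₂ n).2
    (hL n) hK (hE₁ n) (hE₂ n) (hfast n)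
  set m := Real.sqrt (2 * Real.log 2 / K) with hm
  have hm0 : 0 < m := by
    have hlog2 : 0 < Real.log 2 := Real.log_pos one_lt_two
    exact Real.sqrt_pos.2 (by positivity)
  have hs0 : ∀ n, 0 ≤ s n := fun n => (ht₁0 n).trans (hs n).1
  have hsT : ∀ n, s n < T := fun n => (hs n).2.trans_lt (ht₂ n).2
  have hdoms : ∀ n, ∀ r ∈ Icc 0 (s n), E r ≤ ENNReal.ofReal (2 * L n) := fun n r hr =>
    hdom2 n r ⟨hr.1, hr.2.trans (hs n).2⟩
  -- (f) the base times `tc n = s n + c_P ν³/(8 (L n)²)`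
  obtain ⟨tc, htc_def⟩ : ∃ tc : ℕ → ℝ, ∀ n, tc n = s n + cP * ν ^ 3 / (8 * L n ^ 2) :=
    ⟨_, fun _ => rfl⟩
  have hδ : ∀ n, 0 < cP * ν ^ 3 / (8 * L n ^ 2) := fun n => by
    have hLn := hL n
    positivity
  have hstc : ∀ n, s n ≤ tc n := fun n => by rw [htc_def]; linarith [hδ n]
  have htc : ∀ n, 0 < tc n ∧ tc n < T := fun n => by
    have hLn := hL n
    have hr := hroom (s n) ⟨hs0 n, hsT n⟩ (2 * L n) (by positivity) (hdoms n)
    have hq : cP * ν ^ 3 / (8 * L n ^ 2) ≤ cP * ν ^ 3 / (2 * L n) ^ 2 :=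
      eighth_le_quarter (by positivity) hLn
    rw [htc_def]
    exact ⟨by linarith [hs0 n, hδ n], by linarith⟩
  -- domination of `E` by `K_P · 2 L n` on `[0, tc n]`
  have hdom : ∀ n, ∀ r ∈ Icc 0 (tc n), E r ≤ ENNReal.ofReal (KP * (2 * L n)) := by
    intro n r hr
    have hLn := hL n
    rcases le_or_gt r (s n) with hle | hlt
    · exact (hdoms n r ⟨hr.1, hle⟩).trans
        (ENNReal.ofReal_le_ofReal (le_mul_of_one_le_left (by positivity) hKP))
    · refine hpers (s n) ⟨hs0 n, hsT n⟩ (2 * L n) (by positivity) (hdoms n (s n) ⟨hs0 n, le_rfl⟩)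
        r ⟨hlt.le, hr.2.trans_lt (htc n).2⟩ ?_
      calc r - s n ≤ cP * ν ^ 3 / (8 * L n ^ 2) := by linarith [hr.2, htc_def n]
        _ ≤ cP * ν ^ 3 / (2 * L n) ^ 2 := eighth_le_quarter (by positivity) hLn
  -- `tc n · (L n)² → ∞`
  have htend : Tendsto (fun n => tc n * (KP * (2 * L n)) ^ 2) atTop atTop := by
    have h0 : Tendsto (fun n : ℕ => T / 2 * (n : ℝ) ^ 2) atTop atTop :=
      Tendsto.const_mul_atTop (half_pos hT)
        ((tendsto_pow_atTop two_ne_zero).comp tendsto_natCast_atTop_atTop)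
    refine tendsto_atTop_mono (f := fun n : ℕ => T / 2 * (n : ℝ) ^ 2) (fun n => ?_) h0
    have hLn := hL n
    have hn2L : (n : ℝ) < 2 * L n :=
      ENNReal.natCast_lt_ofReal.1
        ((htpn n).trans_le (hdom2 n (tp n) ⟨(htp n).1, (ht₁ n).1.trans (ht₂ n).1.le⟩))
    have hnL : (n : ℝ) ≤ KP * (2 * L n) :=
      hn2L.le.trans (le_mul_of_one_le_left (by positivity) hKP)
    have htcn : T / 2 ≤ tc n := ((htp2 n).le.trans (ht₁ n).1).trans ((hs n).1.trans (hstc n))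
    exact mul_le_mul htcn (pow_le_pow_left₀ (Nat.cast_nonneg n) hnL 2) (by positivity)
      ((half_pos hT).le.trans htcn)
  -- the velocity at the rescaled time `s₀` (the original time `s n`) and the centre `x n`
  have hvel : ∀ n, m / (2 * KP) ≤
      ‖(ν / (KP * (2 * L n))) • u (tc n + ν ^ 3 / (KP * (2 * L n)) ^ 2 * -(cP * KP ^ 2 / 2))
        (x n)‖ := fun n => by
    have hLn := hL n
    have htime : tc n + ν ^ 3 / (KP * (2 * L n)) ^ 2 * -(cP * KP ^ 2 / 2) = s n := by
      rw [htc_def]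
      exact base_time_identity hKP0.ne' hLn.ne'
    have hcoef : 0 ≤ ν / (KP * (2 * L n)) := by positivity
    rw [htime, norm_smul, Real.norm_of_nonneg hcoef, ← velocity_scale m hν.ne' hKP0.ne' hLn.ne']
    exact mul_le_mul_of_nonneg_left (hx n).le hcoef
  exact ⟨tc, x, fun n => KP * (2 * L n), -(cP * KP ^ 2 / 2), m / (2 * KP),
    neg_lt_zero.2 (by positivity), by positivity, htc, fun n => mul_pos hKP0 (mul_pos two_pos (hL n)),
    hdom, htend, hvel⟩

end Summit.NavierStokesRegularity.NavierStokesRegularity.Theorems.RecordZoomAncient.Birth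

end
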